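import Mathlib.Analysis.SpecialFunctions.Trigonometric.Deriv
import Mathlib.Analysis.SpecialFunctions.Trigonometric.Inverse
import Mathlib.Algebra.MvPolynomial.PDeriv
import Mathlib.Algebra.MvPolynomial.CommRing
import Literature.Analysis.Approximation.MarkovInequality
import Literature.Computability.QuantumComplexity.FHKLInfluenceBounds
import HarnessLib

/-!
# Filmus–Hatami–Keller–Lifshitz, Theorem 3.3: `Inf⁽¹⁾[f] ≤ d²` — discharge of `FilmusEtAl2016_thm33`

Topic `Computability/QuantumComplexity`. This file proves the named fact
`Literature.Computability.QuantumComplexity.FilmusEtAl2016_thm33` of `FHKLInfluenceBounds.lean`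
(Y. Filmus, H. Hatami, N. Keller, N. Lifshitz, *On the sum of the L₁ influences of bounded
functions*, Israel J. Math. 214 (2016) 167–192 = arXiv:1404.3396, **Theorem 3.3**, PDF p. 6:
"Let `f : {-1,1}ⁿ → [-1,1]` be a function of degree `d`. Then `Inf[f] ≤ ‖Δ(f)‖_∞ ≤ d²`") as
`FilmusEtAl2016_thm33_holds`, in the tree's `{0,1}ᴺ → [0,1]` dictionary of that file: for a real
polynomial `p` of total degree `≤ d` with `0 ≤ p ≤ 1` on `{0,1}ᴺ`,
`∑ᵢ E_X |p(X) - p(Xⁱ)| ≤ d²`.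

## The printed proof and what is formalized

The printed proof (loc. cit., p. 6) is three lines: `Inf[f] = ‖Δ(f)‖₁ ≤ ‖Δ(f)‖_∞`;
`Δ(f)(x) = ∑ᵢ |fᵢ(x)| = Df(x)y` for a suitable sign vector `y ∈ {-1,1}ⁿ` (`f` multilinear, so
`∂f/∂xᵢ (x) = fᵢ(x)/xᵢ`); and **Proposition 3.2** (Sarantopoulos 1991, Bernstein–Markov for
polynomials on a Banach space, here `(ℝⁿ, ‖·‖_∞)` whose unit ball is the solid cube, on which the
multilinear `f` is still bounded by `1`): `|DP(x)y| ≤ d²` for `‖x‖, ‖y‖ ≤ 1`. The paper remarks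
that the classical (one-variable) Bernstein–Markov theorem only yields `2d²` (split `y` into its
inward and outward parts at the vertex `x`), so the Banach-space inequality is essential for the
constant `d²` that the fact states.

Formalization (same architecture; Sarantopoulos' inequality is proved in exactly the generality
used, by the Bernstein–Schur device of the tree's `MarkovInequality.lean` one dimension up):

1. `FHKL.corner_markov` — **Markov's inequality for the square at a corner, tangential
   direction**: if `P(s,t)` has total degree `≤ d` and `|P| ≤ M` on `[-1,1]²`, then
   `|∂ₛP(1,1) - ∂ₜP(1,1)| = |∑ₘ cₘ (m₀ - m₁)| ≤ d² M`. Proof: for every `φ`,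
   `θ ↦ P(cos(θ+φ), cos(θ-φ))` stays in the square; its odd part is `sin θ · U_φ(cos θ)` with
   `U_φ` a polynomial of degree `< d` (`FHKL.oddPart₂`, assembled from the even/odd parts
   `rotPair` of `cos(θ ± φ)^m` of `MarkovInequality.lean`), `|U_φ(y)| √(1-y²) ≤ M`, so Schur's
   lemma (`schur_inequality`, `SchurInequality.lean`) at `y = 1` gives `|U_φ(1)| ≤ d M`; and
   `U_φ(1) = -sin φ · h(cos φ)` for the diagonal polynomial `h = ∑ₘ cₘ (m₀ - m₁) X^{m₀+m₁-1}`
   (`FHKL.cornerPoly`, degree `< d`), i.e. `|h(y)| √(1-y²) ≤ d M` on `[-1,1]`, so Schur's lemma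
   at `1` again gives `|h(1)| = |∑ₘ cₘ (m₀ - m₁)| ≤ d · d M`. (For the cube this is precisely the
   content of Prop. 3.2 that Thm. 3.3 needs: the Bernstein step along the inscribed ellipses
   `(cos(θ+φ), cos(θ-φ))`, then the Markov step along the diagonal.)
2. `FHKL.planePoly`, `FHKL.signed_sum_le` — the reduction of the cube to the square: for a vertex
   `x₀` and a 2-colouring `κ` of the coordinates, `Q(s,t) = ∑ₓ p(x) ∏ᵢ wᵢ(xᵢ)` with
   `wᵢ = (1 ± s)/2` or `(1 ± t)/2` (the multilinear extension of `x ↦ p(x)` on the 2-plane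
   through the vertex) satisfies `0 ≤ Q ≤ 1` on `[-1,1]²` (a convex combination,
   `FHKL.eval_planePoly_mem`), `totalDegree Q ≤ d` (monomial expansion of `p`,
   `FHKL.planePoly_eq_sum_support`), and `∂ₛQ(1,1) - ∂ₜQ(1,1) = ½ ∑ᵢ ±(p(x₀) - p(x₀ⁱ))`
   (`FHKL.evalOne_pderiv_planePoly`); step 1 applied to `Q - ½` (`M = ½`) gives
   `∑ᵢ ±(p(x₀) - p(x₀ⁱ)) ≤ d²` for every sign pattern, hence (`FHKL.sum_abs_sub_flipBit_le`)
   the pointwise bound `∑ᵢ |p(x₀) - p(x₀ⁱ)| ≤ d²` = "`‖Δ(f)‖_∞ ≤ d²`" (recall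
   `fᵢ = (f - f∘⊕eᵢ)/2 = p - pⁱ` under `f = 2p - 1`).
3. `FilmusEtAl2016_thm33_holds` — averaging over `x₀`: `Inf[f] = ‖Δ(f)‖₁ ≤ ‖Δ(f)‖_∞ ≤ d²`.

No new named facts are introduced (D-0026): every intermediate statement is a theorem proved here.

## References

* [FilmusEtAl2016] Y. Filmus, H. Hatami, N. Keller, N. Lifshitz, *On the sum of the L₁
  influences of bounded functions*, Israel J. Math. 214 (2016) 167–192,
  doi:10.1007/s11856-016-1355-0, arXiv:1404.3396 — Thm. 3.3 and its proof, Prop. 3.1–3.2 (PDF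
  p. 6; held: `lit read arxiv:1404.3396`, p0006).
* Y. Sarantopoulos, *Bounds on the derivatives of polynomials on Banach spaces*, Math. Proc.
  Cambridge Philos. Soc. 110 (1991) 307–312 (the printed Prop. 3.2).
* [Korneichuk1991] N. Korneichuk, *Exact Constants in Approximation Theory*, §3.5.4 (Schur's
  lemma 3.5.9, Bernstein 3.5.7, Markov 3.5.8) — the one-variable tools, tree files
  `Literature/Analysis/Approximation/{SchurInequality, MarkovInequality}.lean`.
-/

open Real Finset

namespace Literature.Computability.QuantumComplexity

open Literature.Analysis.Approximation

namespace FHKL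

section CornerMarkov

open Polynomial

/-! ### Markov's inequality for the square at a corner (Prop. 3.2 as used by Thm. 3.3) -/

/-- `e_m(1) = cos^m φ` for the even part `e_m = (rotPair φ m).1`. [folklore] -/
theorem rotPair_fst_eval_one (φ : ℝ) (m : ℕ) : ((rotPair φ m).1).eval 1 = cos φ ^ m := by
  induction m with
  | zero => simp [rotPair]
  | succ m ih =>
    simp only [rotPair, eval_sub, eval_mul, eval_C, eval_X, eval_pow, eval_one, ih]
    ring

/-- `o_m(1) = -m sin φ cos^{m-1} φ` for the odd part `o_m = (rotPair φ m).2`. [folklore] -/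
theorem rotPair_snd_eval_one (φ : ℝ) (m : ℕ) :
    ((rotPair φ m).2).eval 1 = -(m * sin φ * cos φ ^ (m - 1)) := by
  induction m with
  | zero => simp [rotPair]
  | succ m ih =>
    simp only [rotPair, eval_sub, eval_mul, eval_C, eval_X, ih, rotPair_fst_eval_one]
    rcases m with _ | m
    · simp
    · simp only [Nat.add_sub_cancel, pow_succ]
      push_cast
      ring

/-- The odd part (in `θ`) of `θ ↦ P(cos(θ+φ), cos(θ-φ))`, divided by `sin θ`, as a polynomial in
`cos θ`: `U_φ = ∑_m c_m (o_{m₀} e_{m₁} - e_{m₀} o_{m₁})`. [folklore] -/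
noncomputable def oddPart₂ (φ : ℝ) (P : MvPolynomial (Fin 2) ℝ) : ℝ[X] :=
  ∑ m ∈ P.support, P.coeff m •
    ((rotPair φ (m 0)).2 * (rotPair φ (m 1)).1 - (rotPair φ (m 0)).1 * (rotPair φ (m 1)).2)

/-- `P(cos(θ+φ), cos(θ-φ)) - P(cos(θ-φ), cos(θ+φ)) = 2 sin θ · U_φ(cos θ)`. [folklore] -/
theorem oddPart₂_spec (φ : ℝ) (P : MvPolynomial (Fin 2) ℝ) (θ : ℝ) :
    MvPolynomial.eval ![cos (θ + φ), cos (θ - φ)] P -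
        MvPolynomial.eval ![cos (θ - φ), cos (θ + φ)] P =
      2 * sin θ * (oddPart₂ φ P).eval (cos θ) := by
  rw [MvPolynomial.eval_eq', MvPolynomial.eval_eq', oddPart₂, eval_finsetSum, Finset.mul_sum,
    ← Finset.sum_sub_distrib]
  refine Finset.sum_congr rfl fun m _ => ?_
  obtain ⟨ha1, ha2⟩ := rotPair_spec φ (m 0) θ
  obtain ⟨hb1, hb2⟩ := rotPair_spec φ (m 1) θ
  simp only [Fin.prod_univ_two, Matrix.cons_val_zero, Matrix.cons_val_one,
    cos_add, cos_sub, eval_smul, eval_sub, eval_mul, smul_eq_mul]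
  rw [ha1, ha2, hb1, hb2]
  ring

/-- `m₀ + m₁ ≤ d` for every monomial of a bivariate `P` of total degree `≤ d`. [folklore] -/
theorem sum_le_of_mem_support {P : MvPolynomial (Fin 2) ℝ} {d : ℕ} (hP : P.totalDegree ≤ d)
    {m : Fin 2 →₀ ℕ} (hm : m ∈ P.support) : m 0 + m 1 ≤ d := by
  have h := MvPolynomial.le_totalDegree hm
  rw [Finsupp.sum_fintype _ _ (fun _ => rfl), Fin.sum_univ_two] at h
  exact h.trans hP

/-- `deg U_φ < d` when `totalDegree P ≤ d`. [folklore] -/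
theorem oddPart₂_degree_lt {φ : ℝ} {P : MvPolynomial (Fin 2) ℝ} {d : ℕ}
    (hP : P.totalDegree ≤ d) : (oddPart₂ φ P).degree < d := by
  unfold oddPart₂
  refine (degree_sum_le _ _).trans_lt ((Finset.sup_lt_iff (WithBot.bot_lt_coe d)).mpr ?_)
  intro m hm
  have hab : m 0 + m 1 ≤ d := sum_le_of_mem_support hP hm
  obtain ⟨hea, hoa⟩ := rotPair_degree φ (m 0)
  obtain ⟨heb, hob⟩ := rotPair_degree φ (m 1)
  refine (degree_smul_le _ _).trans_lt ((degree_sub_le _ _).trans_lt (max_lt ?_ ?_))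
  · refine degree_lt_of_degree_mul_X_le (m := m 0 + m 1) ?_ hab
    rw [mul_right_comm]
    simpa using degree_mul_le_of_le hoa heb
  · refine degree_lt_of_degree_mul_X_le (m := m 0 + m 1) ?_ hab
    rw [mul_assoc]
    simpa using degree_mul_le_of_le hea hob

/-- The odd part inherits the bound: `|P| ≤ M` on `[-1,1]²` gives `|U_φ(y)| √(1-y²) ≤ M` on
`[-1, 1]`. [folklore] -/
theorem oddPart₂_bound {φ : ℝ} {P : MvPolynomial (Fin 2) ℝ} {M : ℝ}
    (hM : ∀ s ∈ Set.Icc (-1 : ℝ) 1, ∀ t ∈ Set.Icc (-1 : ℝ) 1, |MvPolynomial.eval ![s, t] P| ≤ M)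
    {y : ℝ} (hy : y ∈ Set.Icc (-1 : ℝ) 1) :
    |(oddPart₂ φ P).eval y| * √(1 - y ^ 2) ≤ M := by
  set ψ := arccos y
  have hc : cos ψ = y := cos_arccos hy.1 hy.2
  have hs : sin ψ = √(1 - y ^ 2) := sin_arccos y
  have h := oddPart₂_spec φ P ψ
  rw [hc] at h
  have hsin : 0 ≤ sin ψ := sin_arccos y ▸ Real.sqrt_nonneg _
  have h1 := hM (cos (ψ + φ)) ⟨neg_one_le_cos _, cos_le_one _⟩ (cos (ψ - φ))
    ⟨neg_one_le_cos _, cos_le_one _⟩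
  have h2 := hM (cos (ψ - φ)) ⟨neg_one_le_cos _, cos_le_one _⟩ (cos (ψ + φ))
    ⟨neg_one_le_cos _, cos_le_one _⟩
  rw [← hs]
  calc |(oddPart₂ φ P).eval y| * sin ψ = |2 * sin ψ * (oddPart₂ φ P).eval y| / 2 := by
        rw [abs_mul, abs_mul, abs_of_nonneg hsin, abs_two]; ring
    _ = |MvPolynomial.eval ![cos (ψ + φ), cos (ψ - φ)] P -
          MvPolynomial.eval ![cos (ψ - φ), cos (ψ + φ)] P| / 2 := by rw [h]
    _ ≤ (|MvPolynomial.eval ![cos (ψ + φ), cos (ψ - φ)] P| +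
          |MvPolynomial.eval ![cos (ψ - φ), cos (ψ + φ)] P|) / 2 := by
        gcongr; exact abs_sub _ _
    _ ≤ M := by linarith

/-- The corner polynomial `h = ∑_m c_m (m₀ - m₁) X^{m₀+m₁-1}`: `(∂_s - ∂_t) P` restricted to the
diagonal `s = t`. [folklore] -/
noncomputable def cornerPoly (P : MvPolynomial (Fin 2) ℝ) : ℝ[X] :=
  ∑ m ∈ P.support, C (P.coeff m * ((m 0 : ℝ) - m 1)) * X ^ (m 0 + m 1 - 1)

/-- `h(1) = ∑_m c_m (m₀ - m₁)`. [folklore] -/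
theorem cornerPoly_eval_one (P : MvPolynomial (Fin 2) ℝ) :
    (cornerPoly P).eval 1 = ∑ m ∈ P.support, P.coeff m * ((m 0 : ℝ) - m 1) := by
  simp [cornerPoly, eval_finsetSum]

/-- `deg h < d` when `totalDegree P ≤ d`. [folklore] -/
theorem cornerPoly_degree_lt {P : MvPolynomial (Fin 2) ℝ} {d : ℕ} (hP : P.totalDegree ≤ d) :
    (cornerPoly P).degree < d := by
  unfold cornerPoly
  refine (degree_sum_le _ _).trans_lt ((Finset.sup_lt_iff (WithBot.bot_lt_coe d)).mpr ?_)
  intro m hm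
  have hab : m 0 + m 1 ≤ d := sum_le_of_mem_support hP hm
  rcases Nat.eq_zero_or_pos (m 0 + m 1) with h0 | hpos
  · have h00 : m 0 = 0 := by omega
    have h01 : m 1 = 0 := by omega
    simp [h00, h01]
  · calc (C (P.coeff m * ((m 0 : ℝ) - m 1)) * X ^ (m 0 + m 1 - 1)).degree
          ≤ ((m 0 + m 1 - 1 : ℕ) : WithBot ℕ) := degree_C_mul_X_pow_le _ _
      _ < (d : WithBot ℕ) := by exact_mod_cast (by omega : m 0 + m 1 - 1 < d)

/-- `U_φ(1) = - sin φ · h(cos φ)`. [folklore] -/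
theorem oddPart₂_eval_one (φ : ℝ) (P : MvPolynomial (Fin 2) ℝ) :
    (oddPart₂ φ P).eval 1 = -(sin φ * (cornerPoly P).eval (cos φ)) := by
  simp only [oddPart₂, cornerPoly, eval_finsetSum, eval_smul, eval_sub, eval_mul, eval_C,
    eval_pow, eval_X, smul_eq_mul, rotPair_fst_eval_one, rotPair_snd_eval_one, Finset.mul_sum,
    ← Finset.sum_neg_distrib]
  refine Finset.sum_congr rfl fun m _ => ?_
  have key : ∀ a b : ℕ, (a : ℝ) * cos φ ^ (a - 1) * cos φ ^ b = a * cos φ ^ (a + b - 1) := by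
    intro a b
    rcases a with _ | a
    · simp
    · rw [Nat.add_sub_cancel, show a + 1 + b - 1 = a + b by omega, pow_add]
      ring
  have k1 := key (m 0) (m 1)
  have k2 := key (m 1) (m 0)
  rw [show m 1 + m 0 = m 0 + m 1 from Nat.add_comm _ _] at k2
  linear_combination (-(P.coeff m * sin φ)) * k1 + (P.coeff m * sin φ) * k2

/-- **Markov's inequality for the square at a corner, tangential direction** (the case of
Sarantopoulos' Banach-space Markov inequality, FHKL Prop. 3.2, that Theorem 3.3 uses): if
`P(s,t)` has total degree `≤ d` and `|P| ≤ M` on `[-1,1]²` then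
`|(∂_s P - ∂_t P)(1,1)| = |∑_m c_m (m₀ - m₁)| ≤ d² M`. Proof: Schur's lemma at `1` twice
(odd part of `θ ↦ P(cos(θ+φ), cos(θ-φ))`, then the diagonal polynomial `h`).
[cite: FilmusEtAl2016, Prop. 3.2 / proof of Thm. 3.3] -/
theorem corner_markov {P : MvPolynomial (Fin 2) ℝ} {d : ℕ} (hP : P.totalDegree ≤ d) {M : ℝ}
    (hM : ∀ s ∈ Set.Icc (-1 : ℝ) 1, ∀ t ∈ Set.Icc (-1 : ℝ) 1, |MvPolynomial.eval ![s, t] P| ≤ M) :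
    |∑ m ∈ P.support, P.coeff m * ((m 0 : ℝ) - m 1)| ≤ (d : ℝ) ^ 2 * M := by
  have h1 : ∀ y ∈ Set.Icc (-1 : ℝ) 1, |(cornerPoly P).eval y| * √(1 - y ^ 2) ≤ d * M := by
    intro y hy
    set φ := arccos y
    have hc : cos φ = y := cos_arccos hy.1 hy.2
    have hs : sin φ = √(1 - y ^ 2) := sin_arccos y
    have hsin : 0 ≤ sin φ := hs ▸ Real.sqrt_nonneg _
    have hu := schur_inequality (oddPart₂_degree_lt (φ := φ) hP)
      (fun z hz => oddPart₂_bound (φ := φ) hM hz) (x := 1) ⟨by norm_num, le_rfl⟩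
    rw [oddPart₂_eval_one, hc, abs_neg, abs_mul, abs_of_nonneg hsin, hs, mul_comm] at hu
    exact hu
  have h2 := schur_inequality (cornerPoly_degree_lt hP) h1 (x := 1) ⟨by norm_num, le_rfl⟩
  rw [cornerPoly_eval_one] at h2
  calc _ ≤ (d : ℝ) * (d * M) := h2
    _ = (d : ℝ) ^ 2 * M := by ring

end CornerMarkov

section Reduction

open MvPolynomial

variable {N : ℕ}

/-! ### The two-plane restriction of the multilinear extension -/

/-- The weight polynomial of coordinate `i` at the bit `b`: `(1 + X_{κ i})/2` if `b` is the base
bit `x₀ i`, `(1 - X_{κ i})/2` otherwise (`κ i ∈ Fin 2` is the block of coordinate `i`).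
[folklore] -/
noncomputable def wPoly (x₀ : Fin N → Bool) (κ : Fin N → Fin 2) (i : Fin N) (b : Bool) :
    MvPolynomial (Fin 2) ℝ :=
  if b = x₀ i then C (1 / 2 : ℝ) + C (1 / 2 : ℝ) * X (κ i)
  else C (1 / 2 : ℝ) - C (1 / 2 : ℝ) * X (κ i)

/-- The bivariate polynomial `Q(s,t) = ∑_x p(x) ∏_i w_i(x_i)`: the multilinear extension of
`x ↦ p(x)` composed with the two-block substitution (block `0 ↦ s`, block `1 ↦ t`, centred at the
vertex `x₀`). [folklore] -/
noncomputable def planePoly (p : MvPolynomial (Fin N) ℝ) (x₀ : Fin N → Bool) (κ : Fin N → Fin 2) :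
    MvPolynomial (Fin 2) ℝ :=
  ∑ x : Fin N → Bool, C (evalBool p x) * ∏ i, wPoly x₀ κ i (x i)

/-- `w_i(b)` at the point `v`: `(1 + v_{κ i})/2` or `(1 - v_{κ i})/2`. [folklore] -/
theorem eval_wPoly (v : Fin 2 → ℝ) (x₀ : Fin N → Bool) (κ : Fin N → Fin 2) (i : Fin N) (b : Bool) :
    eval v (wPoly x₀ κ i b) =
      if b = x₀ i then (1 + v (κ i)) / 2 else (1 - v (κ i)) / 2 := by
  unfold wPoly
  split_ifs <;> simp <;> ring

/-- The weights are nonnegative on the square `[-1,1]²`. [folklore] -/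
theorem eval_wPoly_nonneg {v : Fin 2 → ℝ} (hv : ∀ k, v k ∈ Set.Icc (-1 : ℝ) 1)
    (x₀ : Fin N → Bool) (κ : Fin N → Fin 2) (i : Fin N) (b : Bool) :
    0 ≤ eval v (wPoly x₀ κ i b) := by
  rw [eval_wPoly]
  have := hv (κ i)
  split_ifs
  · linarith [this.1]
  · linarith [this.2]

/-- The two weights of a coordinate sum to `1`. [folklore] -/
theorem wPoly_true_add_false (x₀ : Fin N → Bool) (κ : Fin N → Fin 2) (i : Fin N) :
    wPoly x₀ κ i true + wPoly x₀ κ i false = 1 := by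
  have h2 : (C (1 / 2 : ℝ) : MvPolynomial (Fin 2) ℝ) + C (1 / 2) = 1 := by
    rw [← C_add]; norm_num
  unfold wPoly
  cases x₀ i with
  | false => rw [if_neg (by decide), if_pos rfl]; linear_combination h2
  | true => rw [if_pos rfl, if_neg (by decide)]; linear_combination h2

/-- The two weights of a coordinate sum to `1` at every point. [folklore] -/
theorem sum_eval_wPoly (v : Fin 2 → ℝ) (x₀ : Fin N → Bool) (κ : Fin N → Fin 2) (i : Fin N) :
    ∑ b, eval v (wPoly x₀ κ i b) = 1 := by
  rw [Fintype.sum_bool, ← map_add, wPoly_true_add_false, map_one]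

/-- `Q(v) = ∑_x p(x) ∏_i w_i(x_i)(v)`. [folklore] -/
theorem eval_planePoly (v : Fin 2 → ℝ) (p : MvPolynomial (Fin N) ℝ) (x₀ : Fin N → Bool)
    (κ : Fin N → Fin 2) :
    eval v (planePoly p x₀ κ) =
      ∑ x : Fin N → Bool, evalBool p x * ∏ i, eval v (wPoly x₀ κ i (x i)) := by
  simp [planePoly, map_sum, map_mul, map_prod, MvPolynomial.eval_C]

/-- The product weights form a probability vector:
`∑_x ∏_i w_i(x_i) = ∏_i (w_i(tt) + w_i(ff)) = 1`. [folklore] -/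
theorem sum_prod_eval_wPoly (v : Fin 2 → ℝ) (x₀ : Fin N → Bool) (κ : Fin N → Fin 2) :
    ∑ x : Fin N → Bool, ∏ i, eval v (wPoly x₀ κ i (x i)) = 1 := by
  rw [← Fintype.prod_sum (fun i b => eval v (wPoly x₀ κ i b))]
  simp only [sum_eval_wPoly, Finset.prod_const_one]

/-- `0 ≤ Q ≤ 1` on the square (a convex combination of the values of `p`). [folklore] -/
theorem eval_planePoly_mem {p : MvPolynomial (Fin N) ℝ}
    (hp : ∀ x, 0 ≤ evalBool p x ∧ evalBool p x ≤ 1) (x₀ : Fin N → Bool) (κ : Fin N → Fin 2)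
    {v : Fin 2 → ℝ} (hv : ∀ k, v k ∈ Set.Icc (-1 : ℝ) 1) :
    0 ≤ eval v (planePoly p x₀ κ) ∧ eval v (planePoly p x₀ κ) ≤ 1 := by
  rw [eval_planePoly]
  have hw : ∀ x : Fin N → Bool, 0 ≤ ∏ i, eval v (wPoly x₀ κ i (x i)) := fun x =>
    Finset.prod_nonneg fun i _ => eval_wPoly_nonneg hv x₀ κ i (x i)
  constructor
  · exact Finset.sum_nonneg fun x _ => mul_nonneg (hp x).1 (hw x)
  · calc _ ≤ ∑ x : Fin N → Bool, 1 * ∏ i, eval v (wPoly x₀ κ i (x i)) :=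
          Finset.sum_le_sum fun x _ => mul_le_mul_of_nonneg_right (hp x).2 (hw x)
      _ = 1 := by simp [sum_prod_eval_wPoly]

/-! ### Degree: the monomial form of `Q` -/

/-- `Q = ∑_m coeff_m(p) ∏_{i : m i ≠ 0} w_i(true)`. [folklore] -/
theorem planePoly_eq_sum_support (p : MvPolynomial (Fin N) ℝ) (x₀ : Fin N → Bool)
    (κ : Fin N → Fin 2) :
    planePoly p x₀ κ =
      ∑ m ∈ p.support, C (p.coeff m) * ∏ i, (if m i = 0 then 1 else wPoly x₀ κ i true) := by
  have hF : ∀ (m : Fin N →₀ ℕ) (i : Fin N),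
      ∑ b : Bool, C ((if b then (1 : ℝ) else 0) ^ m i) * wPoly x₀ κ i b =
        if m i = 0 then 1 else wPoly x₀ κ i true := by
    intro m i
    rw [Fintype.sum_bool]
    by_cases h : m i = 0
    · simp [h, wPoly_true_add_false]
    · simp [h]
  calc planePoly p x₀ κ
      = ∑ x : Fin N → Bool, ∑ m ∈ p.support,
          C (p.coeff m) * ∏ i, (C ((if x i then (1 : ℝ) else 0) ^ m i) * wPoly x₀ κ i (x i)) := by
        unfold planePoly
        refine Finset.sum_congr rfl fun x _ => ?_
        rw [evalBool, MvPolynomial.eval_eq', map_sum, Finset.sum_mul]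
        refine Finset.sum_congr rfl fun m _ => ?_
        rw [map_mul, map_prod, mul_assoc, ← Finset.prod_mul_distrib]
    _ = ∑ m ∈ p.support, C (p.coeff m) *
          ∑ x : Fin N → Bool,
            ∏ i, (C ((if x i then (1 : ℝ) else 0) ^ m i) * wPoly x₀ κ i (x i)) := by
        rw [Finset.sum_comm]
        refine Finset.sum_congr rfl fun m _ => ?_
        rw [Finset.mul_sum]
    _ = _ := by
        refine Finset.sum_congr rfl fun m _ => ?_
        congr 1
        rw [← Fintype.prod_sum (fun i b => C ((if b then (1 : ℝ) else 0) ^ m i) * wPoly x₀ κ i b)]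
        exact Finset.prod_congr rfl fun i _ => hF m i

/-- Each weight is affine: `totalDegree w_i(b) ≤ 1`. [folklore] -/
theorem totalDegree_wPoly_le (x₀ : Fin N → Bool) (κ : Fin N → Fin 2) (i : Fin N) (b : Bool) :
    (wPoly x₀ κ i b).totalDegree ≤ 1 := by
  have hCX : (C (1 / 2 : ℝ) * X (κ i) : MvPolynomial (Fin 2) ℝ).totalDegree ≤ 1 :=
    (totalDegree_mul _ _).trans (by simp [totalDegree_X])
  unfold wPoly
  split_ifs
  · exact (totalDegree_add _ _).trans (max_le (by simp) hCX)
  · exact (totalDegree_sub _ _).trans (max_le (by simp) hCX)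

/-- `totalDegree Q ≤ totalDegree p`. [folklore] -/
theorem totalDegree_planePoly_le {p : MvPolynomial (Fin N) ℝ} {d : ℕ} (hp : p.totalDegree ≤ d)
    (x₀ : Fin N → Bool) (κ : Fin N → Fin 2) : (planePoly p x₀ κ).totalDegree ≤ d := by
  rw [planePoly_eq_sum_support]
  refine totalDegree_finsetSum_le fun m hm => ?_
  refine (totalDegree_mul _ _).trans ?_
  rw [totalDegree_C, zero_add]
  refine (totalDegree_finsetProd _ _).trans ?_
  have hdeg : ∑ i, m i ≤ d := by
    have := le_totalDegree hm
    rw [Finsupp.sum_fintype _ _ (fun _ => rfl)] at this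
    exact this.trans hp
  refine le_trans (Finset.sum_le_sum fun i _ => ?_) hdeg
  split_ifs with h
  · simp
  · exact (totalDegree_wPoly_le x₀ κ i true).trans (Nat.one_le_iff_ne_zero.mpr h)

/-! ### The partial derivatives of `Q` at the corner `(1,1)` -/

/-- Leibniz rule for `pderiv` over a finite product. [folklore] -/
theorem pderiv_finset_prod {σ ι : Type*} [DecidableEq ι] (k : σ) (s : Finset ι)
    (f : ι → MvPolynomial σ ℝ) :
    pderiv k (∏ i ∈ s, f i) = ∑ i ∈ s, (∏ j ∈ s.erase i, f j) * pderiv k (f i) := by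
  induction s using Finset.induction_on with
  | empty => simp
  | insert a s ha ih =>
    rw [Finset.prod_insert ha, Derivation.leibniz, smul_eq_mul, smul_eq_mul, Finset.sum_insert ha,
      Finset.erase_insert ha, ih, Finset.mul_sum, add_comm]
    congr 1
    refine Finset.sum_congr rfl fun i hi => ?_
    have hia : a ≠ i := fun h => ha (h ▸ hi)
    rw [Finset.erase_insert_of_ne hia,
      Finset.prod_insert (fun h => ha (Finset.mem_of_mem_erase h))]
    ring

/-- At the corner `(1,1)` the weights are the indicator of the base bit:
`w_i(b)(1,1) = [b = x₀ i]`. [folklore] -/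
theorem evalOne_wPoly (x₀ : Fin N → Bool) (κ : Fin N → Fin 2) (i : Fin N) (b : Bool) :
    eval (fun _ => (1 : ℝ)) (wPoly x₀ κ i b) = if b = x₀ i then 1 else 0 := by
  rw [eval_wPoly]
  split_ifs <;> norm_num

/-- At the corner, `∂_k w_i(b) = ± ½ [κ i = k]`. [folklore] -/
theorem evalOne_pderiv_wPoly (k : Fin 2) (x₀ : Fin N → Bool) (κ : Fin N → Fin 2) (i : Fin N)
    (b : Bool) :
    eval (fun _ => (1 : ℝ)) (pderiv k (wPoly x₀ κ i b)) =
      if κ i = k then (if b = x₀ i then 1 / 2 else -(1 / 2)) else 0 := by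
  unfold wPoly
  by_cases hk : κ i = k
  · subst hk
    rw [if_pos rfl]
    split_ifs <;> simp [pderiv_X]
  · rw [if_neg hk]
    split_ifs <;> simp [pderiv_X, hk]

/-- A point agreeing with `x₀` off `i` is `x₀` or `x₀` with bit `i` flipped. [folklore] -/
theorem eq_or_eq_flipBit_of_forall_ne {x₀ c : Fin N → Bool} {i : Fin N}
    (h : ∀ j, j ≠ i → c j = x₀ j) : c = x₀ ∨ c = flipBit i x₀ := by
  by_cases hc : c i = x₀ i
  · left
    funext j
    by_cases hj : j = i
    · subst hj; exact hc
    · exact h j hj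
  · right
    funext j
    by_cases hj : j = i
    · subst hj
      have e : flipBit j x₀ j = !x₀ j := by simp [flipBit]
      rw [e]
      revert hc
      cases c j <;> cases x₀ j <;> simp
    · have e : flipBit i x₀ j = x₀ j := by simp [flipBit, hj]
      rw [e, h j hj]

/-- `eval₁ (∂_k Q) = ½ ∑_{i : κ i = k} (p(x₀) - p(x₀^i))`. [folklore] -/
theorem evalOne_pderiv_planePoly (k : Fin 2) (p : MvPolynomial (Fin N) ℝ) (x₀ : Fin N → Bool)
    (κ : Fin N → Fin 2) :
    eval (fun _ => (1 : ℝ)) (pderiv k (planePoly p x₀ κ)) =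
      ∑ i, if κ i = k then (evalBool p x₀ - evalBool p (flipBit i x₀)) / 2 else 0 := by
  simp only [planePoly, map_sum, pderiv_C_mul, map_mul, MvPolynomial.eval_C, pderiv_finset_prod,
    map_prod, evalOne_wPoly, evalOne_pderiv_wPoly, Finset.mul_sum]
  rw [Finset.sum_comm]
  refine Finset.sum_congr rfl fun i _ => ?_
  by_cases hk : κ i = k
  · simp only [hk, if_true]
    rw [Finset.sum_eq_add (x₀) (flipBit i x₀)]
    · -- the two surviving terms
      have h1 : (∏ j ∈ Finset.univ.erase i, if x₀ j = x₀ j then (1 : ℝ) else 0) = 1 :=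
        Finset.prod_eq_one fun j _ => if_pos rfl
      have h2 : (∏ j ∈ Finset.univ.erase i, if flipBit i x₀ j = x₀ j then (1 : ℝ) else 0) = 1 :=
        Finset.prod_eq_one fun j hj => if_pos (by simp [flipBit, Finset.ne_of_mem_erase hj])
      have h3 : ¬ (flipBit i x₀ i = x₀ i) := by
        cases hx : x₀ i <;> simp [flipBit, hx]
      rw [h1, h2, if_pos rfl, if_neg h3]
      ring
    · intro h
      have := congrFun h i
      revert this
      cases hx : x₀ i <;> simp [flipBit, hx]
    · intro c _ hc
      have hex : ∃ j, j ≠ i ∧ c j ≠ x₀ j := by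
        by_contra hne
        push Not at hne
        rcases eq_or_eq_flipBit_of_forall_ne hne with h | h
        · exact hc.1 h
        · exact hc.2 h
      obtain ⟨j, hji, hcj⟩ := hex
      rw [Finset.prod_eq_zero (Finset.mem_erase.mpr ⟨hji, Finset.mem_univ j⟩) (if_neg hcj)]
      ring
    · intro h; exact absurd (Finset.mem_univ _) h
    · intro h; exact absurd (Finset.mem_univ _) h
  · simp [hk]

/-- `eval₁ (∂_k P) = ∑_m coeff_m(P) m_k` for a bivariate `P`. [folklore] -/
theorem evalOne_pderiv_eq_sum_support (k : Fin 2) (P : MvPolynomial (Fin 2) ℝ) :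
    eval (fun _ => (1 : ℝ)) (pderiv k P) = ∑ m ∈ P.support, P.coeff m * (m k : ℝ) := by
  conv_lhs => rw [P.as_sum]
  rw [map_sum, map_sum]
  refine Finset.sum_congr rfl fun m _ => ?_
  rw [pderiv_monomial, eval_monomial]
  simp [Finsupp.prod]

/-! ### From the square back to the cube: the pointwise bound `‖Δ(f)‖_∞ ≤ d²` -/

/-- The signed pointwise bound: for every vertex `x₀` and every 2-colouring `κ` of the
coordinates, `∑ᵢ ±(p(x₀) - p(x₀ⁱ)) ≤ d²` (sign `+` on colour `0`, `-` on colour `1`) — the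
inequality `|Df(x)y| ≤ d²` of the printed proof. [cite: FilmusEtAl2016, proof of Thm. 3.3] -/
theorem signed_sum_le {p : MvPolynomial (Fin N) ℝ} {d : ℕ} (hp : p.totalDegree ≤ d)
    (hb : ∀ x, 0 ≤ evalBool p x ∧ evalBool p x ≤ 1) (x₀ : Fin N → Bool) (κ : Fin N → Fin 2) :
    ∑ i, (if κ i = 0 then (1 : ℝ) else -1) * (evalBool p x₀ - evalBool p (flipBit i x₀)) ≤
      (d : ℝ) ^ 2 := by
  have h01 : ∀ a : Fin 2, a = 0 ∨ a = 1 := by decide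
  set Q := planePoly p x₀ κ with hQdef
  set P := Q - C (1 / 2 : ℝ) with hPdef
  have hPdeg : P.totalDegree ≤ d :=
    (totalDegree_sub_C_le _ _).trans (totalDegree_planePoly_le hp x₀ κ)
  have hPM : ∀ s ∈ Set.Icc (-1 : ℝ) 1, ∀ t ∈ Set.Icc (-1 : ℝ) 1, |eval ![s, t] P| ≤ 1 / 2 := by
    intro s hs t ht
    have hv : ∀ k, (![s, t] : Fin 2 → ℝ) k ∈ Set.Icc (-1 : ℝ) 1 := by
      intro k
      rcases h01 k with rfl | rfl
      · simpa using hs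
      · simpa using ht
    obtain ⟨h0, h1⟩ := eval_planePoly_mem hb x₀ κ hv
    rw [hPdef, map_sub, eval_C, abs_le]
    constructor <;> linarith
  have hcm := corner_markov hPdeg hPM
  have hPQ : ∀ k, pderiv k P = pderiv k Q := fun k => by
    rw [hPdef, map_sub, pderiv_C, sub_zero]
  have hsum : ∑ m ∈ P.support, P.coeff m * ((m 0 : ℝ) - m 1) =
      (∑ i, (if κ i = 0 then (1 : ℝ) else -1) *
        (evalBool p x₀ - evalBool p (flipBit i x₀))) / 2 := by
    have e0 := evalOne_pderiv_eq_sum_support 0 P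
    have e1 := evalOne_pderiv_eq_sum_support 1 P
    rw [hPQ] at e0 e1
    calc ∑ m ∈ P.support, P.coeff m * ((m 0 : ℝ) - m 1)
        = ∑ m ∈ P.support, P.coeff m * (m 0 : ℝ) - ∑ m ∈ P.support, P.coeff m * (m 1 : ℝ) := by
          rw [← Finset.sum_sub_distrib]
          exact Finset.sum_congr rfl fun m _ => by ring
      _ = eval (fun _ => (1 : ℝ)) (pderiv 0 Q) - eval (fun _ => (1 : ℝ)) (pderiv 1 Q) := by
          rw [e0, e1]
      _ = _ := by
          rw [hQdef, evalOne_pderiv_planePoly, evalOne_pderiv_planePoly, ← Finset.sum_sub_distrib,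
            Finset.sum_div]
          refine Finset.sum_congr rfl fun i _ => ?_
          rcases h01 (κ i) with hk | hk
          · simp [hk]
          · simp [hk]
            ring
  rw [hsum, abs_le] at hcm
  linarith [hcm.2]

/-- **`‖Δ(f)‖_∞ ≤ d²`** (the middle inequality of Thm. 3.3, through `fᵢ = p - pⁱ`): for every
vertex `x₀`, `∑ᵢ |p(x₀) - p(x₀ⁱ)| ≤ d²`. [cite: FilmusEtAl2016, Thm. 3.3] -/
theorem sum_abs_sub_flipBit_le {p : MvPolynomial (Fin N) ℝ} {d : ℕ} (hp : p.totalDegree ≤ d)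
    (hb : ∀ x, 0 ≤ evalBool p x ∧ evalBool p x ≤ 1) (x₀ : Fin N → Bool) :
    ∑ i, |evalBool p x₀ - evalBool p (flipBit i x₀)| ≤ (d : ℝ) ^ 2 := by
  set κ : Fin N → Fin 2 := fun i =>
    if 0 ≤ evalBool p x₀ - evalBool p (flipBit i x₀) then 0 else 1 with hκ
  calc ∑ i, |evalBool p x₀ - evalBool p (flipBit i x₀)|
      = ∑ i, (if κ i = 0 then (1 : ℝ) else -1) * (evalBool p x₀ - evalBool p (flipBit i x₀)) := by
        refine Finset.sum_congr rfl fun i _ => ?_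
        by_cases ha : 0 ≤ evalBool p x₀ - evalBool p (flipBit i x₀)
        · have hi : κ i = 0 := if_pos ha
          rw [hi, if_pos rfl, one_mul, abs_of_nonneg ha]
        · have hi : κ i = 1 := if_neg ha
          rw [hi, if_neg (by decide), abs_of_neg (not_le.mp ha)]
          ring
    _ ≤ _ := signed_sum_le hp hb x₀ κ

end Reduction

end FHKL

/-- **Filmus–Hatami–Keller–Lifshitz 2016, Theorem 3.3** (`Inf⁽¹⁾[f] ≤ ‖Δ(f)‖_∞ ≤ d²` for
`f : {-1,1}ⁿ → [-1,1]` of degree `d`), in the tree's dictionary `f = 2p - 1`: discharge of the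
named fact `FilmusEtAl2016_thm33`. Proof as printed: average over the cube of the pointwise bound
`FHKL.sum_abs_sub_flipBit_le` (`‖Δ(f)‖_∞ ≤ d²`, from the corner Markov inequality
`FHKL.corner_markov` = Prop. 3.2 for the square). [cite: FilmusEtAl2016, Thm. 3.3 (p. 6)] -/
theorem FilmusEtAl2016_thm33_holds : FilmusEtAl2016_thm33 := by
  intro N d p hp hb
  calc ∑ i : Fin N, boolAvg (fun x => |evalBool p x - evalBool p (flipBit i x)|)
      = boolAvg (fun x => ∑ i : Fin N, |evalBool p x - evalBool p (flipBit i x)|) := by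
        simp only [boolAvg]
        rw [← Finset.sum_div, Finset.sum_comm]
    _ ≤ boolAvg (fun _ : Fin N → Bool => (d : ℝ) ^ 2) := by
        simp only [boolAvg]
        exact div_le_div_of_nonneg_right
          (Finset.sum_le_sum fun x _ => FHKL.sum_abs_sub_flipBit_le hp hb x) (by positivity)
    _ = (d : ℝ) ^ 2 := boolAvg_const _

end Literature.Computability.QuantumComplexity
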